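import Literature.MathematicalPhysics.QuantumLattice.KomaPiFluxPrintedModel
import HarnessLib

/-!
# The `η`-pseudospin `su(2)` algebra of the on-site pair operators (Koma 2022, (3.8)–(3.10))

T. Koma, *Nambu–Goldstone modes for superconducting lattice fermions*, arXiv:2201.13135 (2022)
[Koma2022], §3: with `Γ⁺_x = a†_{x↑}a†_{x↓}`, `Γ⁻_x = a_{x↓}a_{x↑}`, `Γ¹ = Γ⁺ + Γ⁻`,
`Γ² = i(Γ⁺ - Γ⁻)` (tree: `PairHopRP.gammaPlus/Minus/One/Two`, `BCSPairHoppingReflectionPositivity.lean`)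
and **`Γ³_x := 1 - n_{x↑} - n_{x↓}`** (3.9), the commutation relations

  `[Γ¹_x, Γ²_x] = 2iΓ³_x` (3.8),  `[Γ²_x, Γ³_x] = 2iΓ¹_x`,  `[Γ³_x, Γ¹_x] = 2iΓ²_x` (3.10)

("the same as those between the spin-1/2 operators"), together with the commutativity of the
`Γ`'s at different sites (even elements of the CAR algebra). These are the algebraic inputs of the
double-commutator estimates (6.25)–(6.33). Everything is PROVED from the tree's CAR identities
(`FermionOperatorsProofs.lean`); no named fact.

## References

* [Koma2022] T. Koma, arXiv:2201.13135, (3.1)–(3.3), (3.8)–(3.10).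
* [EsslerEtAl2005] F. H. L. Essler et al., *The one-dimensional Hubbard model* (2005), §2.1–2.2
  (CAR bookkeeping, `η`-pairing operators).
-/

noncomputable section

namespace Literature.MathematicalPhysics.QuantumLattice

open Matrix Finset HubbardWave0

namespace PairHopRP

variable {Λ : Type*} [LinearOrder Λ] [Fintype Λ]

/-! ### `Γ³` and the on-site relations -/

/-- **`Γ³_x = 1 - n_{x↑} - n_{x↓}`**, the generator of the `U(1)` (pseudospin-`z`) rotations.
[cite: Koma2022, (3.9)] -/
def gammaThree (x : Λ) : Matrix (Finset (Orb Λ)) (Finset (Orb Λ)) ℂ := 1 - numberOp x 0 - numberOp x 1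

/-- `Γ³_x` is Hermitian. [cite: Koma2022, (3.9)] -/
theorem gammaThree_isHermitian (x : Λ) : (gammaThree x).IsHermitian := by
  unfold gammaThree numberOp
  refine (isHermitian_one.sub ?_).sub ?_
  · exact numberAt_isHermitian (orb x 0)
  · exact numberAt_isHermitian (orb x 1)

/-- `Γ⁻_xΓ⁺_x - Γ⁺_xΓ⁻_x = Γ³_x` (`= (1-n↑)(1-n↓) - n↑n↓`). [cite: Koma2022, (3.8) (last line)] -/
theorem gammaMinus_mul_gammaPlus_sub (x : Λ) :
    gammaMinus x * gammaPlus x - gammaPlus x * gammaMinus x = gammaThree x := by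
  rw [KomaPiFlux.gammaMinus_mul_gammaPlus, KomaPiFlux.gammaPlus_mul_gammaMinus, gammaThree]
  noncomm_ring

/-- **(3.8)**: `[Γ¹_x, Γ²_x] = 2iΓ³_x`. [cite: Koma2022, (3.8)] -/
theorem gammaOne_comm_gammaTwo (x : Λ) :
    gammaOne x * gammaTwo x - gammaTwo x * gammaOne x = (2 * Complex.I) • gammaThree x := by
  rw [← gammaMinus_mul_gammaPlus_sub, gammaOne, gammaTwo]
  simp only [Matrix.mul_smul, Matrix.smul_mul, Matrix.add_mul, Matrix.mul_add, Matrix.sub_mul, Matrix.mul_sub,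
    smul_add, smul_sub]
  module

/-- `[n_{yσ}, Γ⁺_x] = δ_{xy} Γ⁺_x` (each number operator of the site counts one member of the pair;
number operators of other sites commute with `Γ⁺_x`). [cite: Koma2022, (3.8)–(3.10)]
[cite: EsslerEtAl2005, §2.2 eq. (2.72)] -/
theorem numberOp_comm_gammaPlus (y x : Λ) (σ : Fin 2) :
    numberOp y σ * gammaPlus x - gammaPlus x * numberOp y σ = if y = x then gammaPlus x else 0 := by
  have h := hop_pair_commutator (orb y σ) (orb y σ) (orb x 0) (orb x 1)
  rw [numberOp, gammaPlus, h]
  by_cases hyx : y = x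
  · subst hyx
    rw [if_pos rfl]
    have hσ : σ = 0 ∨ σ = 1 := by fin_cases σ <;> simp
    rcases hσ with rfl | rfl
    · rw [if_pos rfl, if_neg (fun h => absurd (orb_eq_orb_iff.1 h).2 (by decide)), sub_zero]
    · rw [if_neg (fun h => absurd (orb_eq_orb_iff.1 h).2 (by decide)), if_pos rfl, zero_sub,
        creation_mul_creation_eq_neg, neg_neg]
  · rw [if_neg hyx, if_neg (fun h => hyx (orb_eq_orb_iff.1 h).1), if_neg (fun h => hyx (orb_eq_orb_iff.1 h).1),
      sub_zero]

/-- `n_{yσ}` is Hermitian (as `numberOp`). [folklore] -/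
private theorem conjTranspose_numberOp' (y : Λ) (σ : Fin 2) : (numberOp y σ)ᴴ = numberOp y σ := by
  rw [numberOp]
  exact (numberAt_isHermitian (orb y σ)).eq

/-- `[n_{yσ}, Γ⁻_x] = -δ_{xy} Γ⁻_x` (adjoint of the previous). [cite: Koma2022, (3.8)–(3.10)] -/
theorem numberOp_comm_gammaMinus (y x : Λ) (σ : Fin 2) :
    numberOp y σ * gammaMinus x - gammaMinus x * numberOp y σ = if y = x then -gammaMinus x else 0 := by
  have h := congrArg conjTranspose (numberOp_comm_gammaPlus y x σ)
  rw [conjTranspose_sub, conjTranspose_mul, conjTranspose_mul, conjTranspose_gammaPlus,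
    conjTranspose_numberOp'] at h
  rw [← neg_sub, h]
  split_ifs
  · rw [conjTranspose_gammaPlus]
  · rw [conjTranspose_zero, neg_zero]

/-- `[Γ³_x, Γ⁺_x] = -2Γ⁺_x` (`Γ⁺` raises the particle number by two). [cite: Koma2022, (3.10)] -/
theorem gammaThree_comm_gammaPlus (x : Λ) :
    gammaThree x * gammaPlus x - gammaPlus x * gammaThree x = -(2 : ℂ) • gammaPlus x := by
  have h0 := numberOp_comm_gammaPlus x x 0
  have h1 := numberOp_comm_gammaPlus x x 1
  rw [if_pos rfl] at h0 h1
  have e : gammaThree x * gammaPlus x - gammaPlus x * gammaThree x =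
      -(numberOp x 0 * gammaPlus x - gammaPlus x * numberOp x 0) -
        (numberOp x 1 * gammaPlus x - gammaPlus x * numberOp x 1) := by
    simp only [gammaThree, Matrix.sub_mul, Matrix.mul_sub, Matrix.one_mul, Matrix.mul_one]
    abel
  rw [e, h0, h1]
  module

/-- `[Γ³_x, Γ⁻_x] = 2Γ⁻_x`. [cite: Koma2022, (3.10)] -/
theorem gammaThree_comm_gammaMinus (x : Λ) :
    gammaThree x * gammaMinus x - gammaMinus x * gammaThree x = (2 : ℂ) • gammaMinus x := by
  have h0 := numberOp_comm_gammaMinus x x 0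
  have h1 := numberOp_comm_gammaMinus x x 1
  rw [if_pos rfl] at h0 h1
  have e : gammaThree x * gammaMinus x - gammaMinus x * gammaThree x =
      -(numberOp x 0 * gammaMinus x - gammaMinus x * numberOp x 0) -
        (numberOp x 1 * gammaMinus x - gammaMinus x * numberOp x 1) := by
    simp only [gammaThree, Matrix.sub_mul, Matrix.mul_sub, Matrix.one_mul, Matrix.mul_one]
    abel
  rw [e, h0, h1]
  module

/-- **(3.10)**: `[Γ³_x, Γ¹_x] = 2iΓ²_x`. [cite: Koma2022, (3.10)] -/
theorem gammaThree_comm_gammaOne (x : Λ) :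
    gammaThree x * gammaOne x - gammaOne x * gammaThree x = (2 * Complex.I) • gammaTwo x := by
  have hp := gammaThree_comm_gammaPlus x
  have hm := gammaThree_comm_gammaMinus x
  have e : gammaThree x * gammaOne x - gammaOne x * gammaThree x =
      (gammaThree x * gammaPlus x - gammaPlus x * gammaThree x) +
        (gammaThree x * gammaMinus x - gammaMinus x * gammaThree x) := by
    rw [gammaOne, Matrix.mul_add, Matrix.add_mul]
    abel
  rw [e, hp, hm, gammaTwo, smul_smul, show (2 * Complex.I) * Complex.I = -2 by
    rw [mul_assoc, Complex.I_mul_I]; ring]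
  module

/-- **(3.10)**: `[Γ²_x, Γ³_x] = 2iΓ¹_x`. [cite: Koma2022, (3.10)] -/
theorem gammaTwo_comm_gammaThree (x : Λ) :
    gammaTwo x * gammaThree x - gammaThree x * gammaTwo x = (2 * Complex.I) • gammaOne x := by
  have hp := gammaThree_comm_gammaPlus x
  have hm := gammaThree_comm_gammaMinus x
  have e : gammaTwo x * gammaThree x - gammaThree x * gammaTwo x =
      Complex.I • (-(gammaThree x * gammaPlus x - gammaPlus x * gammaThree x) +
        (gammaThree x * gammaMinus x - gammaMinus x * gammaThree x)) := by
    rw [gammaTwo, Matrix.smul_mul, Matrix.mul_smul, Matrix.sub_mul, Matrix.mul_sub, ← smul_sub]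
    congr 1
    abel
  rw [e, hp, hm, gammaOne]
  module

/-! ### Operators at different sites commute -/

/-- `c†_a` commutes with a pair of creators. [cite: EsslerEtAl2005, §2.1 eq. (2.2a)] -/
theorem creation_comm_pair (a p q : Orb Λ) :
    creation a * (creation p * creation q) = creation p * creation q * creation a := by
  rw [← Matrix.mul_assoc, creation_mul_creation_eq_neg a p, Matrix.neg_mul, Matrix.mul_assoc,
    creation_mul_creation_eq_neg a q, Matrix.mul_neg, neg_neg, Matrix.mul_assoc]

/-- `c_a` commutes with a pair of creators on other orbitals. [cite: EsslerEtAl2005, §2.1 eq. (2.2b)] -/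
theorem annihilation_comm_pair {a p q : Orb Λ} (hp : a ≠ p) (hq : a ≠ q) :
    annihilation a * (creation p * creation q) = creation p * creation q * annihilation a := by
  rw [← Matrix.mul_assoc, annihilation_mul_creation, if_neg hp, zero_sub, Matrix.neg_mul, Matrix.mul_assoc,
    annihilation_mul_creation, if_neg hq, zero_sub, Matrix.mul_neg, neg_neg, Matrix.mul_assoc]

/-- `Γ⁺_x Γ⁺_y = Γ⁺_y Γ⁺_x`. [cite: Koma2022, §3 (pair operators at different sites commute)] -/
theorem gammaPlus_comm (x y : Λ) : gammaPlus x * gammaPlus y = gammaPlus y * gammaPlus x := by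
  unfold gammaPlus
  calc creation (orb x 0) * creation (orb x 1) * (creation (orb y 0) * creation (orb y 1))
      = creation (orb x 0) * (creation (orb x 1) * (creation (orb y 0) * creation (orb y 1))) := by
        rw [Matrix.mul_assoc]
    _ = creation (orb x 0) * (creation (orb y 0) * creation (orb y 1) * creation (orb x 1)) := by
        rw [creation_comm_pair (orb x 1)]
    _ = creation (orb x 0) * (creation (orb y 0) * creation (orb y 1)) * creation (orb x 1) := by
        rw [← Matrix.mul_assoc]
    _ = creation (orb y 0) * creation (orb y 1) * creation (orb x 0) * creation (orb x 1) := by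
        rw [creation_comm_pair (orb x 0)]
    _ = creation (orb y 0) * creation (orb y 1) * (creation (orb x 0) * creation (orb x 1)) := by
        rw [Matrix.mul_assoc]

/-- `Γ⁻_x Γ⁺_y = Γ⁺_y Γ⁻_x` for `x ≠ y`. [cite: Koma2022, §3] -/
theorem gammaMinus_comm_gammaPlus_of_ne {x y : Λ} (hxy : x ≠ y) :
    gammaMinus x * gammaPlus y = gammaPlus y * gammaMinus x := by
  have h1 : ∀ σ τ : Fin 2, orb x σ ≠ orb y τ := fun σ τ h => hxy (orb_eq_orb_iff.1 h).1
  unfold gammaMinus gammaPlus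
  calc annihilation (orb x 1) * annihilation (orb x 0) * (creation (orb y 0) * creation (orb y 1))
      = annihilation (orb x 1) * (annihilation (orb x 0) * (creation (orb y 0) * creation (orb y 1))) := by
        rw [Matrix.mul_assoc]
    _ = annihilation (orb x 1) * (creation (orb y 0) * creation (orb y 1) * annihilation (orb x 0)) := by
        rw [annihilation_comm_pair (h1 0 0) (h1 0 1)]
    _ = annihilation (orb x 1) * (creation (orb y 0) * creation (orb y 1)) * annihilation (orb x 0) := by
        rw [← Matrix.mul_assoc]
    _ = creation (orb y 0) * creation (orb y 1) * annihilation (orb x 1) * annihilation (orb x 0) := by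
        rw [annihilation_comm_pair (h1 1 0) (h1 1 1)]
    _ = creation (orb y 0) * creation (orb y 1) * (annihilation (orb x 1) * annihilation (orb x 0)) := by
        rw [Matrix.mul_assoc]

/-- `Γ⁻_x Γ⁻_y = Γ⁻_y Γ⁻_x`. [cite: Koma2022, §3] -/
theorem gammaMinus_comm (x y : Λ) : gammaMinus x * gammaMinus y = gammaMinus y * gammaMinus x := by
  have h := congrArg conjTranspose (gammaPlus_comm y x)
  rwa [conjTranspose_mul, conjTranspose_mul, conjTranspose_gammaPlus, conjTranspose_gammaPlus] at h

/-- `Γ⁺_x Γ⁻_y = Γ⁻_y Γ⁺_x` for `x ≠ y`. [cite: Koma2022, §3] -/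
theorem gammaPlus_comm_gammaMinus_of_ne {x y : Λ} (hxy : x ≠ y) :
    gammaPlus x * gammaMinus y = gammaMinus y * gammaPlus x :=
  (gammaMinus_comm_gammaPlus_of_ne (Ne.symm hxy)).symm

/-- `Γ¹_x Γ¹_y = Γ¹_y Γ¹_x`. [cite: Koma2022, §3] -/
theorem gammaOne_comm (x y : Λ) : gammaOne x * gammaOne y = gammaOne y * gammaOne x := by
  by_cases hxy : x = y
  · rw [hxy]
  · rw [gammaOne, gammaOne]
    simp only [Matrix.add_mul, Matrix.mul_add]
    rw [gammaPlus_comm x y, gammaPlus_comm_gammaMinus_of_ne hxy, gammaMinus_comm_gammaPlus_of_ne hxy,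
      gammaMinus_comm x y]
    abel

/-- `Γ²_x Γ²_y = Γ²_y Γ²_x`. [cite: Koma2022, §3] -/
theorem gammaTwo_comm (x y : Λ) : gammaTwo x * gammaTwo y = gammaTwo y * gammaTwo x := by
  by_cases hxy : x = y
  · rw [hxy]
  · rw [gammaTwo, gammaTwo]
    simp only [Matrix.smul_mul, Matrix.mul_smul, Matrix.sub_mul, Matrix.mul_sub]
    rw [gammaPlus_comm x y, gammaPlus_comm_gammaMinus_of_ne hxy, gammaMinus_comm_gammaPlus_of_ne hxy,
      gammaMinus_comm x y]
    module

/-- `Γ¹_x Γ²_y = Γ²_y Γ¹_x` for `x ≠ y`. [cite: Koma2022, §3] -/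
theorem gammaOne_comm_gammaTwo_of_ne {x y : Λ} (hxy : x ≠ y) :
    gammaOne x * gammaTwo y = gammaTwo y * gammaOne x := by
  rw [gammaOne, gammaTwo]
  simp only [Matrix.mul_smul, Matrix.smul_mul, Matrix.add_mul, Matrix.mul_add, Matrix.mul_sub, Matrix.sub_mul]
  rw [gammaPlus_comm x y, gammaPlus_comm_gammaMinus_of_ne hxy, gammaMinus_comm_gammaPlus_of_ne hxy,
    gammaMinus_comm x y]
  module

/-- `Γ³_y Γ⁺_x = Γ⁺_x Γ³_y` for `x ≠ y`. [cite: Koma2022, §3] -/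
theorem gammaThree_comm_gammaPlus_of_ne {x y : Λ} (hxy : y ≠ x) :
    gammaThree y * gammaPlus x = gammaPlus x * gammaThree y := by
  have h0 := numberOp_comm_gammaPlus y x 0
  have h1 := numberOp_comm_gammaPlus y x 1
  rw [if_neg hxy] at h0 h1
  rw [gammaThree, Matrix.sub_mul, Matrix.sub_mul, Matrix.mul_sub, Matrix.mul_sub, Matrix.one_mul, Matrix.mul_one,
    sub_eq_zero.1 h0, sub_eq_zero.1 h1]

/-- `Γ³_y Γ⁻_x = Γ⁻_x Γ³_y` for `x ≠ y`. [cite: Koma2022, §3] -/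
theorem gammaThree_comm_gammaMinus_of_ne {x y : Λ} (hxy : y ≠ x) :
    gammaThree y * gammaMinus x = gammaMinus x * gammaThree y := by
  have h0 := numberOp_comm_gammaMinus y x 0
  have h1 := numberOp_comm_gammaMinus y x 1
  rw [if_neg hxy] at h0 h1
  rw [gammaThree, Matrix.sub_mul, Matrix.sub_mul, Matrix.mul_sub, Matrix.mul_sub, Matrix.one_mul, Matrix.mul_one,
    sub_eq_zero.1 h0, sub_eq_zero.1 h1]

end PairHopRP

end Literature.MathematicalPhysics.QuantumLattice

end
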